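import Summits.HodgeConjecture.HodgeConjecture.Theses.TropicalWeilObstruction
import Summits.HodgeConjecture.HodgeConjecture.Theorems.TropicalWeilObstructionTropicalWeilVanishingCalibrationCone
import Summits.HodgeConjecture.HodgeConjecture.Theorems.TropicalWeilObstructionTropicalHodgeBoundClassesEigenwave
import Summits.HodgeConjecture.HodgeConjecture.Theorems.TropicalWeilObstructionTropicalWeilVanishingNoLift
import HarnessLib

/-!
# Route `TropicalWeilObstruction` (Kontsevich's tropical test — NEGATION SINK, exploration, no summit claim):
# the frame span of an effective tropical `4`-cycle on a very general tropical Weil eightfold — I. master identity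

Negation-sink bookkeeping of the cell `pub-hodge-tropical` (seat tropical-1 gen 6), a NECESSARY CONDITION on the
effective tropical `4`-cycles that the open crux K1 (`TropicalWeilVanishing`, stmt-HodgeConjecture-18478) speaks
about, and hence on every SEED that could refute it (K1-SCOPE §4A). Part I of three (`…FrameSpanMaster`,
`…FrameSpanWeilPlane`, `…FrameSpanRank`).

Setting: `X_Q = ℝ⁸/Qℤ⁸` with `Q ≻ 0`, `QJ = JQ`, `IsWeilGeneric 4 Q` (very general member of the tropical Weil
family), `Z` an effective tropical `4`-cycle in certificate format (`TropicalTorusCycle 8 4 Q`), `p_σ ∈ ⋀⁴ℤ⁸` the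
Plücker vector of the frame of the cell `σ`, so that `cyc Z = Σ_σ w_σ a_σ p_σ ⊗ p_σ` (`w_σ a_σ > 0`). By K3
(`stub_rationalHodgeCoordinates`, p322554) and the calibration cone (p332805), `cyc Z = q₀ θ₄(Q) + q₁ Re w(Q) + q₂ Im w(Q)`
with `q₀ ≥ 0`, `64(q₁² + q₂²) ≤ q₀²`.

* `cyc_ne_zero`, `exists_coordinates_pos` — a NON-EMPTY effective cycle has `cyc Z ≠ 0`, hence `q₀ > 0`;
  `exists_frameComplexDet_ne_zero` — it has a TOTALLY REAL cell (`η_σ ≠ 0`): `μ(Z) = q₀ det(PQPᴴ) > 0` (p331596).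
* `sum_det_inv_submatrix_mul`, `sum_det_inv_submatrix_mul_omega`, `det_M_mul_det_M_inv` — all-maps Cauchy–Binet:
  `⋀⁴Q⁻¹ ∘ ⋀⁴Q = 4!`, `⋀⁴Q⁻¹ Ω = 4! det M_{Q⁻¹} Ω`, `det M_Q det M_{Q⁻¹} = 1` (`QΩ = Ω M_Q`, p334819).
* `alt_eq_re_of_annihilates` — the MASTER IDENTITY: if a real function `y` on words annihilates every `p_σ`
  (`Σ_S p_σ(S) y(S) = 0`), then its alternating projection is `T ↦ Re(ξ Ω(T))` with
  `ξ = -((q₁ - iq₂)/q₀) Σ_S Ω(S) y(S)` (`Ω(T) = det Ω⟦4⟧[T,·]`): rows of `cyc Z` pair to zero with `y`,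
  `w(Q) = det M_Q · Ω ⊗ Ω`, and `⋀⁴Q` is inverted by `⋀⁴Q⁻¹`.

Parts II–III derive: the annihilator of the frames lies in the Weil plane `span{Re Ω, Im Ω}` of forms and is at most a
line; the frames span `≥ 69` of the `70` dimensions of `⋀⁴ℝ⁸` (`70` if `W(Z) = 0`); `Z` has `≥ 69` cells in pairwise
distinct `4`-planes; and the same for every UNOBSTRUCTED type at `Q = 1` (seeds). HONEST STATUS. Linear algebra on top
of landed files; it constrains the SIZE of seeds and decides nothing about K1 or about the Hodge conjecture.
No definition, no named fact, no sorry.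

References: [Zharkov2020TropicalWeil] I. Zharkov, Tropical abelian varieties, Weil classes and the Hodge conjecture,
arXiv:2002.02347, §2 (pp. 2–4); [MikhalkinZharkov2014Eigenwave] G. Mikhalkin, I. Zharkov, Tropical eigenwave and
intermediate Jacobians, LN UMI 15 (2014), Def. 4.2, Prop. 4.3, Thm. 5.4; Cauchy–Binet [folklore].
-/

set_option linter.dupNamespace false

noncomputable section

open scoped BigOperators
open Matrix
open Literature.AlgebraicGeometry.Tropical
open Summit.HodgeConjecture.HodgeConjecture.Theorems.TropicalHodgeBound

namespace Summit.HodgeConjecture.HodgeConjecture.Theorems.TropicalWeilVanishing.FrameSpan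

/-! ## §0 Display-only notation (the K3 skeleton's local definitions, verbatim bodies; nothing is defined) -/

/-- `P = [1 | i·1]`, the `n × 2n` matrix of `dz₁ ∧ … ∧ dz_n`. -/
local notation3 (prettyPrint := false) "𝐏⟦" n "⟧" =>
  (Matrix.of fun (k : Fin n) (a : Fin (2 * n)) =>
    (if (a : ℕ) = (k : ℕ) then (1 : ℂ) else 0) + (if (a : ℕ) = (k : ℕ) + n then Complex.I else 0))

/-- The skeleton's `dzCoord n S`. -/
local notation3 (prettyPrint := false) "dz⟦" n "⟧" S:max =>
  (Matrix.det (Matrix.of fun k a : Fin n =>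
    (if (S a : ℕ) = (k : ℕ) then (1 : ℂ) else 0) + (if (S a : ℕ) = (k : ℕ) + n then Complex.I else 0)))

/-- The skeleton's `weilPairing n C` (the value `Ŵ(C)` of `dz ⊗ dz`). -/
local notation3 (prettyPrint := false) "Ŵ⟦" n "⟧" C:max =>
  (∑ S : Fin n → Fin (2 * n), ∑ S' : Fin n → Fin (2 * n),
    dz⟦n⟧ S * dz⟦n⟧ S' / ((Nat.factorial n : ℂ) ^ 2) * ((C S S' : ℝ) : ℂ))

/-- The hermitian pairing `M̂(C)` (the value of `dz ⊗ dz̄` on `C`). -/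
local notation3 (prettyPrint := false) "M̂⟦" n "⟧" C:max =>
  (∑ S : Fin n → Fin (2 * n), ∑ S' : Fin n → Fin (2 * n),
    dz⟦n⟧ S * (starRingEnd ℂ) (dz⟦n⟧ S') / ((Nat.factorial n : ℂ) ^ 2) * ((C S S' : ℝ) : ℂ))

/-- The skeleton's `thetaClass n Q`. -/
local notation3 (prettyPrint := false) "θ⟦" n "⟧" Q:max =>
  (fun S S' : Fin n → Fin (2 * n) => Matrix.det (Matrix.submatrix Q S S'))

/-- The skeleton's `omegaFrame n` (`Ω = Pᴴ`). -/
local notation3 (prettyPrint := false) "Ω⟦" n "⟧" =>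
  (Matrix.of fun (a : Fin (2 * n)) (b : Fin n) =>
    (if (a : ℕ) = (b : ℕ) then (1 : ℂ) else 0) - (if (a : ℕ) = (b : ℕ) + n then Complex.I else 0))

/-- The skeleton's `weilClassC n Q` (`w(Q) = (⋀ⁿQ ⊗ 1)(Ω ⊗ Ω)`). -/
local notation3 (prettyPrint := false) "wC⟦" n "⟧" Q:max =>
  (fun S S' : Fin n → Fin (2 * n) =>
    Matrix.det (Matrix.submatrix (Matrix.map Q ((↑) : ℝ → ℂ) * Ω⟦n⟧) S id) *
      Matrix.det (Matrix.submatrix (Ω⟦n⟧) S' id))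

/-- The skeleton's `weilClassRe n Q` (`w₁ = Re w`). -/
local notation3 (prettyPrint := false) "wRe⟦" n "⟧" Q:max =>
  (fun S S' : Fin n → Fin (2 * n) => Complex.re ((wC⟦n⟧ Q) S S'))

/-- The skeleton's `weilClassIm n Q` (`w₂ = Im w`). -/
local notation3 (prettyPrint := false) "wIm⟦" n "⟧" Q:max =>
  (fun S S' : Fin n → Fin (2 * n) => Complex.im ((wC⟦n⟧ Q) S S'))

/-- `M_Q := ½ · P Q Pᴴ`, the matrix of `Q|_{V^{1,0}}` in the frame `Ω` (`QΩ = Ω M_Q`). Nothing is defined. -/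
local notation3 (prettyPrint := false) "𝐌⟦" n "⟧" Q:max =>
  ((2 : ℂ)⁻¹ • (𝐏⟦n⟧ * Matrix.map Q ((↑) : ℝ → ℂ) * (𝐏⟦n⟧)ᴴ))

/-- NEW display-only notation: the `Ω`-minor `Ω(S) := det Ω⟦4⟧[S,·] ∈ ℤ[i]` of a word `S` (the value of
`dz̄₁ ∧ dz̄₂ ∧ dz̄₃ ∧ dz̄₄` on `e_S`). Nothing is defined. -/
local notation3 (prettyPrint := false) "Ωm" S:max => (Matrix.det (Matrix.submatrix (Ω⟦4⟧) S id))

/-! ## §1 Non-empty effective cycles at a very general Weil period: `cyc Z ≠ 0`, `q₀ > 0`, a totally real cell -/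

/-- The diagonal of the cycle class is a sum of non-negative terms `w_σ a_σ p_σ(S)²`; a non-empty effective cycle
has `cyc Z ≠ 0`. [cite: MikhalkinZharkov2014Eigenwave, Prop. 4.3] -/
theorem cyc_ne_zero {Q : Matrix (Fin (2 * 4)) (Fin (2 * 4)) ℝ} (Z : TropicalTorusCycle (2 * 4) 4 Q)
    (hZ : 0 < Z.numCells) : TropicalTorusCycle.cyc Z ≠ 0 := by
  intro h
  set σ₀ : Fin Z.numCells := ⟨0, hZ⟩
  obtain ⟨S, hS⟩ := exists_pluckerCoord_ne_zero (Z.cell σ₀)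
  have hdiag := congrFun (congrFun h S) S
  simp only [Pi.zero_apply] at hdiag
  unfold TropicalTorusCycle.cyc at hdiag
  have hle : ((Z.cell σ₀).weight : ℝ) * (Z.cell σ₀).latticeVolume *
      ((pluckerCoord (Z.cell σ₀).frame S : ℤ) : ℝ) * ((pluckerCoord (Z.cell σ₀).frame S : ℤ) : ℝ) ≤ 0 := by
    rw [← hdiag]
    refine Finset.single_le_sum (f := fun σ => ((Z.cell σ).weight : ℝ) * (Z.cell σ).latticeVolume *
      ((pluckerCoord (Z.cell σ).frame S : ℤ) : ℝ) * ((pluckerCoord (Z.cell σ).frame S : ℤ) : ℝ)) ?_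
      (Finset.mem_univ σ₀)
    intro σ _
    have h1 : (0 : ℝ) ≤ ((Z.cell σ).weight : ℝ) := Nat.cast_nonneg _
    have h2 : (0 : ℝ) ≤ (Z.cell σ).latticeVolume := (latticeVolume_pos _).le
    have h3 : (0 : ℝ) ≤ ((pluckerCoord (Z.cell σ).frame S : ℤ) : ℝ) * ((pluckerCoord (Z.cell σ).frame S : ℤ) : ℝ) :=
      mul_self_nonneg _
    calc (0 : ℝ) ≤ ((Z.cell σ).weight : ℝ) * (Z.cell σ).latticeVolume *
        (((pluckerCoord (Z.cell σ).frame S : ℤ) : ℝ) * ((pluckerCoord (Z.cell σ).frame S : ℤ) : ℝ)) := by positivity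
      _ = _ := by ring
  have hpos : 0 < ((Z.cell σ₀).weight : ℝ) * (Z.cell σ₀).latticeVolume *
      ((pluckerCoord (Z.cell σ₀).frame S : ℤ) : ℝ) * ((pluckerCoord (Z.cell σ₀).frame S : ℤ) : ℝ) := by
    have h1 : (0 : ℝ) < ((Z.cell σ₀).weight : ℝ) := by exact_mod_cast (Z.cell σ₀).weight_pos
    have h2 : (0 : ℝ) < (Z.cell σ₀).latticeVolume := latticeVolume_pos _
    have h3 : ((pluckerCoord (Z.cell σ₀).frame S : ℤ) : ℝ) ≠ 0 := by exact_mod_cast hS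
    have h4 : (0 : ℝ) < ((pluckerCoord (Z.cell σ₀).frame S : ℤ) : ℝ) * ((pluckerCoord (Z.cell σ₀).frame S : ℤ) : ℝ) :=
      mul_self_pos.mpr h3
    calc (0 : ℝ) < ((Z.cell σ₀).weight : ℝ) * (Z.cell σ₀).latticeVolume *
        (((pluckerCoord (Z.cell σ₀).frame S : ℤ) : ℝ) * ((pluckerCoord (Z.cell σ₀).frame S : ℤ) : ℝ)) := by positivity
      _ = _ := by ring
  linarith

/-- **K3 coordinates of a NON-EMPTY effective cycle have `q₀ > 0`.** At a very general Weil period the class of an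
effective tropical `4`-cycle is `q₀ θ₄(Q) + q₁ Re w(Q) + q₂ Im w(Q)` with `q₀ ≥ 0`, `64(q₁²+q₂²) ≤ q₀²` (the calibration
cone, p332805); if the cycle has a cell then `cyc Z ≠ 0`, so `q₀ > 0`.
[cite: Zharkov2020TropicalWeil, §2] [cite: MikhalkinZharkov2014Eigenwave, Prop. 4.3] -/
theorem exists_coordinates_pos (Q : Matrix (Fin (2 * 4)) (Fin (2 * 4)) ℝ) (hQ : Q.PosDef)
    (hJ : Q * weilJ 4 = weilJ 4 * Q) (hgen : IsWeilGeneric 4 Q) (Z : TropicalTorusCycle (2 * 4) 4 Q)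
    (hZ : 0 < Z.numCells) :
    ∃ q : Fin 3 → ℚ,
      TropicalTorusCycle.cyc Z = ((q 0 : ℚ) : ℝ) • θ⟦4⟧ Q + ((q 1 : ℚ) : ℝ) • wRe⟦4⟧ Q +
        ((q 2 : ℚ) : ℝ) • wIm⟦4⟧ Q ∧ 0 < q 0 ∧ 64 * ((q 1) ^ 2 + (q 2) ^ 2) ≤ (q 0) ^ 2 := by
  obtain ⟨q, hq, hq0, hcone⟩ := effective_cyc_mem_calibrationCone Q hQ hJ hgen Z
  refine ⟨q, hq, lt_of_le_of_ne hq0 ?_, hcone⟩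
  intro h0
  have h1 : q 1 = 0 := by rw [← h0] at hcone; nlinarith [sq_nonneg (q 1), sq_nonneg (q 2)]
  have h2 : q 2 = 0 := by rw [← h0] at hcone; nlinarith [sq_nonneg (q 1), sq_nonneg (q 2)]
  refine cyc_ne_zero Z hZ ?_
  rw [hq, ← h0, h1, h2]
  simp


/-- **A non-empty effective cycle at a very general Weil period has a TOTALLY REAL cell** (`η_σ ≠ 0`, i.e. the
direction `4`-plane `L_σ` satisfies `L_σ ⊕ J L_σ = ℝ⁸`): `μ(Z) = Σ_σ w_σ a_σ |η_σ|² = q₀ · det(P Q Pᴴ)` (hermitian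
pairing, p331596) with `q₀ > 0`. [cite: Zharkov2020TropicalWeil, §2] [cite: MikhalkinZharkov2014Eigenwave, Prop. 4.3] -/
theorem exists_frameComplexDet_ne_zero (Q : Matrix (Fin (2 * 4)) (Fin (2 * 4)) ℝ) (hQ : Q.PosDef)
    (hJ : Q * weilJ 4 = weilJ 4 * Q) (hgen : IsWeilGeneric 4 Q) (Z : TropicalTorusCycle (2 * 4) 4 Q)
    (hZ : 0 < Z.numCells) : ∃ σ, frameComplexDet 4 (Z.cell σ).frame ≠ 0 := by
  obtain ⟨q, hq, hq0, -⟩ := exists_coordinates_pos Q hQ hJ hgen Z hZ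
  have h4 : (0 : ℕ) < 4 := by norm_num
  have hM0 := hermPairing_cyc Q Z
  rw [hq, hermPairing_lincomb, hermPairing_thetaClass_eq_det, hermPairing_weilClassRe_eq_zero h4 Q hJ,
    hermPairing_weilClassIm_eq_zero h4 Q hJ, mul_zero, mul_zero, add_zero, add_zero] at hM0
  obtain ⟨hDre, -⟩ := det_frame_mul_map_mul_conjTranspose_pos Q hQ
  by_contra hall
  push Not at hall
  have hμ : (∑ σ, ((Z.cell σ).weight : ℝ) * (Z.cell σ).latticeVolume *
      ‖frameComplexDet 4 (Z.cell σ).frame‖ ^ 2) = 0 := by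
    refine Finset.sum_eq_zero fun σ _ => ?_
    rw [hall σ, norm_zero]; ring
  rw [hμ, Complex.ofReal_zero] at hM0
  have hD : (𝐏⟦4⟧ * Q.map ((↑) : ℝ → ℂ) * (𝐏⟦4⟧)ᴴ).det = 0 :=
    (mul_eq_zero.mp hM0).resolve_left (by exact_mod_cast hq0.ne')
  rw [hD, Complex.zero_re] at hDre
  exact lt_irrefl _ hDre

/-! ## §2 Inverting `⋀⁴Q` and pairing with `Ω` by all-maps Cauchy–Binet -/

/-- `Q⁻¹` commutes with `J` when `Q` does. [cite: Zharkov2020TropicalWeil, §2] -/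
theorem inv_mul_weilJ_comm (Q : Matrix (Fin (2 * 4)) (Fin (2 * 4)) ℝ) (hQd : IsUnit Q.det)
    (hJ : Q * weilJ 4 = weilJ 4 * Q) : Q⁻¹ * weilJ 4 = weilJ 4 * Q⁻¹ := by
  calc Q⁻¹ * weilJ 4 = Q⁻¹ * weilJ 4 * (Q * Q⁻¹) := by rw [Matrix.mul_nonsing_inv _ hQd, Matrix.mul_one]
    _ = Q⁻¹ * (weilJ 4 * Q) * Q⁻¹ := by simp only [Matrix.mul_assoc]
    _ = Q⁻¹ * (Q * weilJ 4) * Q⁻¹ := by rw [hJ]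
    _ = weilJ 4 * Q⁻¹ := by rw [← Matrix.mul_assoc, Matrix.nonsing_inv_mul _ hQd, Matrix.one_mul]

/-- **`⋀⁴Q⁻¹ ∘ ⋀⁴Q = 4!` on all words:** `Σ_S det Q⁻¹[T,S] · det Q[S,S'] = 24 · det 1[T,S']`. [folklore] -/
theorem sum_det_inv_submatrix_mul (Q : Matrix (Fin (2 * 4)) (Fin (2 * 4)) ℝ) (hQd : IsUnit Q.det)
    (T S' : Fin 4 → Fin (2 * 4)) :
    ∑ S : Fin 4 → Fin (2 * 4), (Q⁻¹.submatrix T S).det * (Q.submatrix S S').det =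
      24 * ((1 : Matrix (Fin (2 * 4)) (Fin (2 * 4)) ℝ).submatrix T S').det := by
  have h := sum_det_submatrix_mul_det_submatrix (Q⁻¹.submatrix T id) (Q.submatrix id S')
  simp only [Matrix.submatrix_submatrix, Function.comp_id, Function.id_comp] at h
  rw [h, ← Matrix.submatrix_mul _ _ _ _ _ Function.bijective_id, Matrix.nonsing_inv_mul _ hQd]
  norm_num [Nat.factorial]

/-- **`⋀⁴Q⁻¹` applied to `Ω`:** `Σ_S det Q⁻¹[T,S] · Ω(S) = 24 · det M_{Q⁻¹} · Ω(T)` (`Q⁻¹Ω = Ω M_{Q⁻¹}`).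
[cite: Zharkov2020TropicalWeil, §2] -/
theorem sum_det_inv_submatrix_mul_omega (Q : Matrix (Fin (2 * 4)) (Fin (2 * 4)) ℝ)
    (hJ' : Q⁻¹ * weilJ 4 = weilJ 4 * Q⁻¹) (T : Fin 4 → Fin (2 * 4)) :
    ∑ S : Fin 4 → Fin (2 * 4), (((Q⁻¹.submatrix T S).det : ℝ) : ℂ) * Ωm S =
      24 * ((𝐌⟦4⟧ Q⁻¹).det * Ωm T) := by
  have h := sum_det_submatrix_mul_det_submatrix ((Q⁻¹.map ((↑) : ℝ → ℂ)).submatrix T id) (Ω⟦4⟧)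
  simp only [Matrix.submatrix_submatrix, Function.comp_id, Function.id_comp] at h
  have hcast : ∀ S : Fin 4 → Fin (2 * 4),
      (((Q⁻¹.submatrix T S).det : ℝ) : ℂ) = ((Q⁻¹.map ((↑) : ℝ → ℂ)).submatrix T S).det := by
    intro S; rw [ofReal_det]; rfl
  simp_rw [hcast]
  have hsub : (Q⁻¹.map ((↑) : ℝ → ℂ)).submatrix T id * Ω⟦4⟧ = ((Q⁻¹.map ((↑) : ℝ → ℂ)) * Ω⟦4⟧).submatrix T id := by
    rw [Matrix.submatrix_mul _ _ _ _ _ Function.bijective_id, Matrix.submatrix_id_id]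
  rw [h, hsub, map_mul_omega_eq_omega_mul Q⁻¹ hJ',
    show (Ω⟦4⟧ * 𝐌⟦4⟧ Q⁻¹).submatrix T id = (Ω⟦4⟧).submatrix T id * 𝐌⟦4⟧ Q⁻¹ from rfl, Matrix.det_mul]
  norm_num [Nat.factorial]
  ring

/-- `P Ω = 2 · 1`. [folklore] -/
theorem frame_mul_omega : 𝐏⟦4⟧ * Ω⟦4⟧ = (2 : ℂ) • (1 : Matrix (Fin 4) (Fin 4) ℂ) := by
  rw [← frame_conjTranspose_eq]; exact frame_mul_frame_conjTranspose

/-- **`det M_Q · det M_{Q⁻¹} = 1`** (`Ω = Q⁻¹QΩ = Ω M_{Q⁻¹} M_Q` and `PΩ = 2`). [cite: Zharkov2020TropicalWeil, §2] -/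
theorem det_M_mul_det_M_inv (Q : Matrix (Fin (2 * 4)) (Fin (2 * 4)) ℝ) (hQd : IsUnit Q.det)
    (hJ : Q * weilJ 4 = weilJ 4 * Q) : (𝐌⟦4⟧ Q).det * (𝐌⟦4⟧ Q⁻¹).det = 1 := by
  have hJ' := inv_mul_weilJ_comm Q hQd hJ
  have h1 : (Q⁻¹).map ((↑) : ℝ → ℂ) * Q.map ((↑) : ℝ → ℂ) = 1 := by
    have e : (Q⁻¹ * Q).map ((↑) : ℝ → ℂ) = (Q⁻¹).map ((↑) : ℝ → ℂ) * Q.map ((↑) : ℝ → ℂ) :=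
      Matrix.map_mul (f := Complex.ofRealHom)
    rw [← e, Matrix.nonsing_inv_mul _ hQd]
    exact Matrix.map_one _ Complex.ofReal_zero Complex.ofReal_one
  have hΩ : Ω⟦4⟧ = Ω⟦4⟧ * (𝐌⟦4⟧ Q⁻¹ * 𝐌⟦4⟧ Q) := by
    calc Ω⟦4⟧ = ((Q⁻¹).map ((↑) : ℝ → ℂ) * Q.map ((↑) : ℝ → ℂ)) * Ω⟦4⟧ := by rw [h1, Matrix.one_mul]
      _ = (Q⁻¹).map ((↑) : ℝ → ℂ) * (Q.map ((↑) : ℝ → ℂ) * Ω⟦4⟧) := by rw [Matrix.mul_assoc]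
      _ = (Q⁻¹).map ((↑) : ℝ → ℂ) * Ω⟦4⟧ * 𝐌⟦4⟧ Q := by
          rw [map_mul_omega_eq_omega_mul Q hJ]; simp only [Matrix.mul_assoc]
      _ = Ω⟦4⟧ * (𝐌⟦4⟧ Q⁻¹ * 𝐌⟦4⟧ Q) := by
          rw [map_mul_omega_eq_omega_mul Q⁻¹ hJ']; simp only [Matrix.mul_assoc]
  have hP : (2 : ℂ) • (1 : Matrix (Fin 4) (Fin 4) ℂ) = (2 : ℂ) • (𝐌⟦4⟧ Q⁻¹ * 𝐌⟦4⟧ Q) := by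
    calc (2 : ℂ) • (1 : Matrix (Fin 4) (Fin 4) ℂ) = 𝐏⟦4⟧ * Ω⟦4⟧ := frame_mul_omega.symm
      _ = 𝐏⟦4⟧ * (Ω⟦4⟧ * (𝐌⟦4⟧ Q⁻¹ * 𝐌⟦4⟧ Q)) := by rw [← hΩ]
      _ = (2 : ℂ) • (𝐌⟦4⟧ Q⁻¹ * 𝐌⟦4⟧ Q) := by rw [← Matrix.mul_assoc, frame_mul_omega, Matrix.smul_mul, Matrix.one_mul]
  have hMM : 𝐌⟦4⟧ Q⁻¹ * 𝐌⟦4⟧ Q = 1 := (smul_right_injective _ (two_ne_zero' ℂ) hP).symm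
  have := congrArg Matrix.det hMM
  rw [Matrix.det_mul, Matrix.det_one] at this
  rw [mul_comm]; exact this

/-! ## §3 The master identity: the alternating projection of an annihilator of the frames -/

/-- `q₁ Re w + q₂ Im w = Re((q₁ - i q₂) w)`. [folklore] -/
theorem re_combo (q1 q2 : ℝ) (w : ℂ) :
    q1 * w.re + q2 * w.im = (((q1 : ℂ) - Complex.I * (q2 : ℂ)) * w).re := by
  simp only [Complex.mul_re, Complex.sub_re, Complex.sub_im, Complex.ofReal_re, Complex.ofReal_im,
    Complex.mul_im, Complex.I_re, Complex.I_im]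
  ring

/-- **Master identity.** If `cyc Z = q₀ θ₄(Q) + q₁ Re w(Q) + q₂ Im w(Q)` with `q₀ ≠ 0` (`Q` invertible, `QJ = JQ`)
and `y` is a real function on words annihilating every cell's Plücker vector (`Σ_S p_σ(S) y(S) = 0` for all `σ`),
then its alternating projection is the real part of a complex multiple of `Ω`:
`Σ_{S'} det 1[T,S'] y(S') = Re(ξ · Ω(T))`, `ξ = -((q₁ - i q₂)/q₀) · Σ_S Ω(S) y(S)`.
(Rows of `cyc Z = Σ_σ w_σ a_σ p_σ ⊗ p_σ` pair to zero with `y`; `w(Q) = det M_Q · Ω ⊗ Ω`; invert `⋀⁴Q` by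
`⋀⁴Q⁻¹`, which maps `Ω` to `det M_{Q⁻¹} · Ω`; `det M_Q det M_{Q⁻¹} = 1`.)
[cite: Zharkov2020TropicalWeil, §2] [cite: MikhalkinZharkov2014Eigenwave, Prop. 4.3] -/
theorem alt_eq_re_of_annihilates {Q : Matrix (Fin (2 * 4)) (Fin (2 * 4)) ℝ} (hQd : IsUnit Q.det)
    (hJ : Q * weilJ 4 = weilJ 4 * Q) (Z : TropicalTorusCycle (2 * 4) 4 Q) (q0 q1 q2 : ℝ)
    (hq : TropicalTorusCycle.cyc Z = q0 • θ⟦4⟧ Q + q1 • wRe⟦4⟧ Q + q2 • wIm⟦4⟧ Q) (hq0 : q0 ≠ 0)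
    (y : (Fin 4 → Fin (2 * 4)) → ℝ)
    (hy : ∀ σ, ∑ S : Fin 4 → Fin (2 * 4), ((pluckerCoord (Z.cell σ).frame S : ℤ) : ℝ) * y S = 0)
    (T : Fin 4 → Fin (2 * 4)) :
    ∑ S' : Fin 4 → Fin (2 * 4), ((1 : Matrix (Fin (2 * 4)) (Fin (2 * 4)) ℝ).submatrix T S').det * y S' =
      (-(((q1 : ℂ) - Complex.I * (q2 : ℂ)) / (q0 : ℂ)) *
        (∑ S : Fin 4 → Fin (2 * 4), Ωm S * ((y S : ℝ) : ℂ)) * Ωm T).re := by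
  have hJ' : Q⁻¹ * weilJ 4 = weilJ 4 * Q⁻¹ := inv_mul_weilJ_comm Q hQd hJ
  set m : ℂ := (𝐌⟦4⟧ Q).det with hm
  set m' : ℂ := (𝐌⟦4⟧ Q⁻¹).det with hm'
  set κ : ℂ := (q1 : ℂ) - Complex.I * (q2 : ℂ) with hκ
  set zC : ℂ := ∑ S : Fin 4 → Fin (2 * 4), Ωm S * ((y S : ℝ) : ℂ) with hzC
  have hmm' : m * m' = 1 := det_M_mul_det_M_inv Q hQd hJ
  -- (a) the rows of `cyc Z` pair to zero with `y`
  have hrow : ∀ S : Fin 4 → Fin (2 * 4), ∑ S', TropicalTorusCycle.cyc Z S S' * y S' = 0 := by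
    intro S
    unfold TropicalTorusCycle.cyc
    simp_rw [Finset.sum_mul]
    rw [Finset.sum_comm]
    refine Finset.sum_eq_zero fun σ _ => ?_
    have h := hy σ
    calc ∑ S' : Fin 4 → Fin (2 * 4), ((Z.cell σ).weight : ℝ) * (Z.cell σ).latticeVolume *
          ((pluckerCoord (Z.cell σ).frame S : ℤ) : ℝ) * ((pluckerCoord (Z.cell σ).frame S' : ℤ) : ℝ) * y S'
        = ((Z.cell σ).weight : ℝ) * (Z.cell σ).latticeVolume * ((pluckerCoord (Z.cell σ).frame S : ℤ) : ℝ) *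
            ∑ S' : Fin 4 → Fin (2 * 4), ((pluckerCoord (Z.cell σ).frame S' : ℤ) : ℝ) * y S' := by
          rw [Finset.mul_sum]
          exact Finset.sum_congr rfl fun S' _ => by ring
      _ = 0 := by rw [h, mul_zero]
  -- (b)+(c) the `θ`-rows of `y` are real parts of multiples of `Ω`
  have hθ : ∀ S : Fin 4 → Fin (2 * 4),
      ∑ S', (Q.submatrix S S').det * y S' = -(1 / q0) * (κ * m * Ωm S * zC).re := by
    intro S
    have hSS : ∀ S', TropicalTorusCycle.cyc Z S S' =
        q0 * (Q.submatrix S S').det + q1 * ((wC⟦4⟧ Q) S S').re + q2 * ((wC⟦4⟧ Q) S S').im := by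
      intro S'; rw [hq]; simp only [Pi.add_apply, Pi.smul_apply, smul_eq_mul]
    have h0 := hrow S
    simp_rw [hSS] at h0
    have hsplit : ∑ S' : Fin 4 → Fin (2 * 4), (q0 * (Q.submatrix S S').det + q1 * ((wC⟦4⟧ Q) S S').re +
        q2 * ((wC⟦4⟧ Q) S S').im) * y S' =
        q0 * ∑ S', (Q.submatrix S S').det * y S' +
          ∑ S', (q1 * ((wC⟦4⟧ Q) S S').re + q2 * ((wC⟦4⟧ Q) S S').im) * y S' := by
      rw [Finset.mul_sum, ← Finset.sum_add_distrib]
      exact Finset.sum_congr rfl fun S' _ => by ring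
    have hre : ∑ S' : Fin 4 → Fin (2 * 4), (q1 * ((wC⟦4⟧ Q) S S').re + q2 * ((wC⟦4⟧ Q) S S').im) * y S' =
        (κ * m * Ωm S * zC).re := by
      rw [hzC, Finset.mul_sum, Complex.re_sum]
      refine Finset.sum_congr rfl fun S' _ => ?_
      rw [weilClassC_eq_det_mul Q hJ S S', re_combo]
      have e : κ * m * Ωm S * (Ωm S' * ((y S' : ℝ) : ℂ)) = (κ * (m * (Ωm S * Ωm S'))) * ((y S' : ℝ) : ℂ) := by
        ring
      rw [e, Complex.re_mul_ofReal]
    rw [hsplit, hre] at h0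
    field_simp
    linarith
  -- (d) invert `⋀⁴Q`
  have hinv : ∀ S' : Fin 4 → Fin (2 * 4), ((1 : Matrix (Fin (2 * 4)) (Fin (2 * 4)) ℝ).submatrix T S').det =
      (1 / 24) * ∑ S, (Q⁻¹.submatrix T S).det * (Q.submatrix S S').det := by
    intro S'; rw [sum_det_inv_submatrix_mul Q hQd T S']; ring
  have hΩsum := sum_det_inv_submatrix_mul_omega Q hJ' T
  calc ∑ S' : Fin 4 → Fin (2 * 4), ((1 : Matrix (Fin (2 * 4)) (Fin (2 * 4)) ℝ).submatrix T S').det * y S'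
      = ∑ S', ((1 / 24) * ∑ S, (Q⁻¹.submatrix T S).det * (Q.submatrix S S').det) * y S' := by
        simp_rw [hinv]
    _ = ∑ S', ∑ S, (1 / 24) * ((Q⁻¹.submatrix T S).det * ((Q.submatrix S S').det * y S')) := by
        refine Finset.sum_congr rfl fun S' _ => ?_
        rw [Finset.mul_sum, Finset.sum_mul]
        exact Finset.sum_congr rfl fun S _ => by ring
    _ = ∑ S, ∑ S', (1 / 24) * ((Q⁻¹.submatrix T S).det * ((Q.submatrix S S').det * y S')) := Finset.sum_comm
    _ = (1 / 24) * ∑ S, (Q⁻¹.submatrix T S).det * ∑ S', (Q.submatrix S S').det * y S' := by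
        rw [Finset.mul_sum]
        refine Finset.sum_congr rfl fun S _ => ?_
        rw [Finset.mul_sum, Finset.mul_sum]
    _ = (1 / 24) * ∑ S, (Q⁻¹.submatrix T S).det * (-(1 / q0) * (κ * m * Ωm S * zC).re) := by
        simp_rw [hθ]
    _ = -(1 / (24 * q0)) * ∑ S, (Q⁻¹.submatrix T S).det * (κ * m * Ωm S * zC).re := by
        rw [Finset.mul_sum, Finset.mul_sum]
        refine Finset.sum_congr rfl fun S _ => ?_
        ring
    _ = -(1 / (24 * q0)) * (κ * m * zC * ∑ S, (((Q⁻¹.submatrix T S).det : ℝ) : ℂ) * Ωm S).re := by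
        congr 1
        rw [Finset.mul_sum, Complex.re_sum]
        refine Finset.sum_congr rfl fun S _ => ?_
        rw [← Complex.re_ofReal_mul]
        congr 1
        ring
    _ = -(1 / (24 * q0)) * (κ * m * zC * (24 * (m' * Ωm T))).re := by rw [hΩsum]
    _ = -(1 / (24 * q0)) * (24 * (m * m') * (κ * zC * Ωm T)).re := by congr 2; ring
    _ = (-(κ / (q0 : ℂ)) * zC * Ωm T).re := by
        rw [hmm', mul_one]
        have hq0' : (q0 : ℂ) ≠ 0 := by exact_mod_cast hq0
        have e : -(κ / (q0 : ℂ)) * zC * Ωm T = ((-(1 / (24 * q0)) : ℝ) : ℂ) * (24 * (κ * zC * Ωm T)) := by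
          push_cast
          field_simp
        rw [e, Complex.re_ofReal_mul]


end Summit.HodgeConjecture.HodgeConjecture.Theorems.TropicalWeilVanishing.FrameSpan

end
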